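import Literature.MathematicalPhysics.KineticTheory.ReyBelletThomas2002Coercive
import Mathlib.Analysis.SpecialFunctions.Pow.Deriv
import HarnessLib

/-!
# Rey-Bellet–Thomas 2002, hypothesis H1: polynomial growth bounds and the high-energy scaling of the potentials

Trunk T-KINETIC (Literature/MathematicalPhysics/KineticTheory). Elementary consequences of H1
(`RBGrowth W k`, `d = 1`: `W ∈ C^∞`, `W(sx)/s^k → a|x|^k`, `W'(sx)/s^{k-1} → a k |x|^{k-2} x`,
`|W''| ≤ (C + D W)^{1-2/k}`) used in the scaling argument of §3.1 of the paper (eqs. (19)–(21):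
"By assumption H1, as `E → ∞` the rescaled energy becomes `G̃_∞`"), towards Theorem 3.3 /
Theorem 3.10 for the named fact `ReyBelletThomas2002_thm21` (provefact unit):

* `RBGrowth.coeff` — the leading coefficient `a > 0`, with the two defining limits;
* `RBGrowth.exists_le_mul_one_add_rpow`, `exists_rpow_sub_le`, `exists_abs_le` —
  `a/2 |z|^k - C ≤ W(z) ≤ C(1 + |z|^k)`, `|W(z)| ≤ C(1 + |z|^k)`;
* `RBGrowth.exists_abs_deriv_le` — `|W'(z)| ≤ C(1 + |z|^{k-1})` (`k ≥ 1`);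
* `RBGrowth.exists_abs_deriv_deriv_le` — `|W''(z)| ≤ C(1 + |z|^{k-2})` (`k ≥ 2`);
* `scaledPot W k E y = E⁻¹ W(E^{1/k} y)` — the rescaled potential `Ũ` of (19), its derivatives
  `E^{1/k-1} W'(E^{1/k}y)`, `E^{2/k-1} W''(E^{1/k}y)`, and the pointwise limits
  `scaledPot → a|y|^k`, `(scaledPot)' → a k |y|^{k-2} y` as `E → ∞`
  (`tendsto_scaledPot`, `tendsto_deriv_scaledPot`);
* uniform bounds for `E ≥ 1` on bounded sets (`exists_forall_abs_deriv_scaledPot_le`,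
  `exists_forall_abs_deriv_deriv_scaledPot_le`: the rescaled forces are equi-Lipschitz), the
  finite-net lemma `eventually_forall_abs_sub_le_of_lipschitz`, and the UNIFORM convergence on
  bounded sets `eventually_forall_abs_scaledPot_sub_limitPot_le`,
  `eventually_forall_abs_deriv_scaledPot_sub_limitForce_le`; uniform coercivity `scaledPot_ge`.

## References

* L. Rey-Bellet, L. E. Thomas, Comm. Math. Phys. **225** (2002) 305–329, §1 H1, §3.1 (19)–(21).
* L. Rey-Bellet, *Open classical systems*, LNM 1881 (2006), §3 (64)–(66).
-/

noncomputable section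

open Filter Set Topology
open scoped Topology

namespace Literature.MathematicalPhysics.KineticTheory.HeatConduction

namespace RBGrowth

variable {W : ℝ → ℝ} {k : ℝ}

/-! ### The leading coefficient -/

/-- The **leading coefficient** `a > 0` of a potential satisfying H1 (`W(sx) ~ a s^k |x|^k`).
[cite: ReyBelletThomas2002, §1 H1] -/
def coeff (h : RBGrowth W k) : ℝ := Classical.choose h.2

/-- `a > 0`. [cite: ReyBelletThomas2002, §1 H1] -/
theorem coeff_pos (h : RBGrowth W k) : 0 < h.coeff := (Classical.choose_spec h.2).1

/-- `W(sx)/s^k → a |x|^k`. [cite: ReyBelletThomas2002, §1 H1] -/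
theorem tendsto_div_rpow (h : RBGrowth W k) (x : ℝ) :
    Tendsto (fun s : ℝ => W (s * x) / s ^ k) atTop (𝓝 (h.coeff * |x| ^ k)) :=
  (Classical.choose_spec h.2).2.1 x

/-- `W'(sx)/s^{k-1} → a k |x|^{k-2} x`. [cite: ReyBelletThomas2002, §1 H1] -/
theorem tendsto_deriv_div_rpow (h : RBGrowth W k) (x : ℝ) :
    Tendsto (fun s : ℝ => deriv W (s * x) / s ^ (k - 1)) atTop
      (𝓝 (h.coeff * k * |x| ^ (k - 2) * x)) :=
  (Classical.choose_spec h.2).2.2.1 x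

/-- `|W''| ≤ (C + D W)^{1 - 2/k}` with `C + D W ≥ 0`. [cite: ReyBelletThomas2002, §1 H1] -/
theorem exists_abs_deriv_deriv_le_rpow (h : RBGrowth W k) :
    ∃ C D : ℝ, ∀ x : ℝ, 0 ≤ C + D * W x ∧ |deriv (deriv W) x| ≤ (C + D * W x) ^ (1 - 2 / k) := by
  obtain ⟨C, D, hCD⟩ := (Classical.choose_spec h.2).2.2.2
  refine ⟨C, D, fun x => ⟨(hCD x).1, ?_⟩⟩
  have : iteratedDeriv 2 W = deriv (deriv W) := by
    rw [iteratedDeriv_succ, iteratedDeriv_one]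
  rw [← this]
  exact (hCD x).2

/-- `W'` is continuous. [folklore] -/
theorem continuous_deriv (h : RBGrowth W k) : Continuous (deriv W) :=
  h.1.continuous_deriv (by norm_cast)

/-- `W` is differentiable. [folklore] -/
theorem differentiable (h : RBGrowth W k) : Differentiable ℝ W :=
  h.1.differentiable (by norm_cast)

/-- `W'` is differentiable. [folklore] -/
theorem differentiable_deriv (h : RBGrowth W k) : Differentiable ℝ (deriv W) := by
  have h2 : ContDiff ℝ 2 W := h.1.of_le (by norm_cast)
  have : (2 : WithTop ℕ∞) = 1 + 1 := by norm_num
  rw [this] at h2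
  exact (h2.deriv').differentiable one_ne_zero

/-! ### Polynomial growth bounds from the ray limits -/

/-- **Upper growth**: `W(z) ≤ C (1 + |z|^k)`. Along `x = ±1` eventually
`W(±s) ≤ (a+1) s^k`, and `W` is bounded on compact intervals. [cite: ReyBelletThomas2002, §1 H1] -/
theorem exists_le_mul_one_add_rpow (h : RBGrowth W k) :
    ∃ C : ℝ, 0 ≤ C ∧ ∀ z : ℝ, W z ≤ C * (1 + |z| ^ k) := by
  set a := h.coeff with ha
  have hev : ∀ x : ℝ, |x| = 1 → ∃ S : ℝ, 1 ≤ S ∧ ∀ s, S ≤ s → W (s * x) ≤ (a + 1) * s ^ k := by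
    intro x hx
    have hl : Tendsto (fun s : ℝ => W (s * x) / s ^ k) atTop (𝓝 a) := by
      simpa [hx] using h.tendsto_div_rpow x
    have h1 : ∀ᶠ s : ℝ in atTop, W (s * x) / s ^ k < a + 1 :=
      hl.eventually (gt_mem_nhds (by linarith))
    obtain ⟨S, hS⟩ := eventually_atTop.1 (h1.and (eventually_ge_atTop 1))
    refine ⟨max S 1, le_max_right _ _, fun s hs => ?_⟩
    obtain ⟨hs1, hs2⟩ := hS s ((le_max_left _ _).trans hs)
    have hsk : 0 < s ^ k := Real.rpow_pos_of_pos (by linarith) k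
    rw [div_lt_iff₀ hsk] at hs1
    exact hs1.le
  obtain ⟨S₁, hS₁1, hS₁⟩ := hev 1 (by simp)
  obtain ⟨S₂, hS₂1, hS₂⟩ := hev (-1) (by simp)
  set S := max S₁ S₂ with hS
  obtain ⟨M, hM⟩ := isCompact_Icc.exists_bound_of_continuousOn
    (h.continuous.continuousOn (s := Icc (-S) S))
  refine ⟨max (max M 0) (a + 1), le_max_of_le_left (le_max_right _ _), fun z => ?_⟩
  have ha1 : 0 < a + 1 := by linarith [h.coeff_pos]
  have hzk : 0 ≤ |z| ^ k := Real.rpow_nonneg (abs_nonneg z) k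
  by_cases hz : |z| ≤ S
  · have hmem : z ∈ Icc (-S) S := ⟨by linarith [neg_abs_le z], (le_abs_self z).trans hz⟩
    calc W z ≤ |W z| := le_abs_self _
      _ ≤ M := by simpa [Real.norm_eq_abs] using hM z hmem
      _ ≤ max (max M 0) (a + 1) := (le_max_left _ _).trans (le_max_left _ _)
      _ ≤ max (max M 0) (a + 1) * (1 + |z| ^ k) :=
          le_mul_of_one_le_right (le_max_of_le_left (le_max_right _ _)) (by linarith)
  · rw [not_le] at hz
    have hbd : W z ≤ (a + 1) * |z| ^ k := by
      rcases le_total 0 z with h0 | h0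
      · have := hS₁ |z| ((le_max_left _ _).trans hz.le)
        have hz' : |z| * 1 = z := by rw [mul_one, abs_of_nonneg h0]
        rwa [hz'] at this
      · have := hS₂ |z| ((le_max_right _ _).trans hz.le)
        have hz' : |z| * -1 = z := by rw [abs_of_nonpos h0]; ring
        rwa [hz'] at this
    calc W z ≤ (a + 1) * |z| ^ k := hbd
      _ ≤ max (max M 0) (a + 1) * |z| ^ k := mul_le_mul_of_nonneg_right (le_max_right _ _) hzk
      _ ≤ max (max M 0) (a + 1) * (1 + |z| ^ k) :=
          mul_le_mul_of_nonneg_left (by linarith) (le_max_of_le_left (le_max_right _ _))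

/-- **Lower growth**: `a/2 |z|^k - C ≤ W(z)` (`k > 0`). [cite: ReyBelletThomas2002, §1 H1] -/
theorem exists_rpow_sub_le (h : RBGrowth W k) (hk : 0 < k) :
    ∃ C : ℝ, 0 ≤ C ∧ ∀ z : ℝ, h.coeff / 2 * |z| ^ k - C ≤ W z := by
  set a := h.coeff with ha
  have ha0 := h.coeff_pos
  have hev : ∀ x : ℝ, |x| = 1 → ∃ S : ℝ, 1 ≤ S ∧ ∀ s, S ≤ s → a / 2 * s ^ k ≤ W (s * x) := by
    intro x hx
    have hl : Tendsto (fun s : ℝ => W (s * x) / s ^ k) atTop (𝓝 a) := by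
      simpa [hx] using h.tendsto_div_rpow x
    have h1 : ∀ᶠ s : ℝ in atTop, a / 2 < W (s * x) / s ^ k :=
      hl.eventually (lt_mem_nhds (by linarith))
    obtain ⟨S, hS⟩ := eventually_atTop.1 (h1.and (eventually_ge_atTop 1))
    refine ⟨max S 1, le_max_right _ _, fun s hs => ?_⟩
    obtain ⟨hs1, hs2⟩ := hS s ((le_max_left _ _).trans hs)
    have hsk : 0 < s ^ k := Real.rpow_pos_of_pos (by linarith) k
    rw [lt_div_iff₀ hsk] at hs1
    exact hs1.le
  obtain ⟨S₁, hS₁1, hS₁⟩ := hev 1 (by simp)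
  obtain ⟨S₂, hS₂1, hS₂⟩ := hev (-1) (by simp)
  set S := max S₁ S₂ with hS
  have hS1 : 1 ≤ S := hS₁1.trans (le_max_left _ _)
  obtain ⟨M, hM⟩ := isCompact_Icc.exists_bound_of_continuousOn
    (h.continuous.continuousOn (s := Icc (-S) S))
  have hM0 : 0 ≤ M := (norm_nonneg _).trans (hM 0 ⟨by linarith, by linarith⟩)
  refine ⟨a / 2 * S ^ k + M, by positivity, fun z => ?_⟩
  by_cases hz : |z| ≤ S
  · have hmem : z ∈ Icc (-S) S := ⟨by linarith [neg_abs_le z], (le_abs_self z).trans hz⟩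
    have h1 : |z| ^ k ≤ S ^ k := Real.rpow_le_rpow (abs_nonneg z) hz hk.le
    have h2 : -M ≤ W z := by
      have := hM z hmem
      rw [Real.norm_eq_abs] at this
      linarith [neg_abs_le (W z)]
    nlinarith [h1, ha0]
  · rw [not_le] at hz
    have hbd : a / 2 * |z| ^ k ≤ W z := by
      rcases le_total 0 z with h0 | h0
      · have := hS₁ |z| ((le_max_left _ _).trans hz.le)
        have hz' : |z| * 1 = z := by rw [mul_one, abs_of_nonneg h0]
        rwa [hz'] at this
      · have := hS₂ |z| ((le_max_right _ _).trans hz.le)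
        have hz' : |z| * -1 = z := by rw [abs_of_nonpos h0]; ring
        rwa [hz'] at this
    have : 0 ≤ a / 2 * S ^ k + M := by positivity
    linarith

/-- `|W(z)| ≤ C (1 + |z|^k)` (`k > 0`). [cite: ReyBelletThomas2002, §1 H1] -/
theorem exists_abs_le (h : RBGrowth W k) (hk : 0 < k) :
    ∃ C : ℝ, 0 ≤ C ∧ ∀ z : ℝ, |W z| ≤ C * (1 + |z| ^ k) := by
  obtain ⟨C₁, hC₁, h₁⟩ := h.exists_le_mul_one_add_rpow
  obtain ⟨C₂, hC₂, h₂⟩ := h.exists_rpow_sub_le hk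
  refine ⟨max C₁ C₂, le_max_of_le_left hC₁, fun z => abs_le.2 ⟨?_, ?_⟩⟩
  · have hzk : 0 ≤ |z| ^ k := Real.rpow_nonneg (abs_nonneg z) k
    have := h₂ z
    have ha := h.coeff_pos
    have : -(max C₁ C₂ * (1 + |z| ^ k)) ≤ -C₂ := by
      have : C₂ ≤ max C₁ C₂ * (1 + |z| ^ k) :=
        (le_max_right _ _).trans (le_mul_of_one_le_right (le_max_of_le_left hC₁) (by linarith))
      linarith
    nlinarith
  · exact (h₁ z).trans (mul_le_mul_of_nonneg_right (le_max_left _ _) (by positivity))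

/-- **Growth of the force**: `|W'(z)| ≤ C (1 + |z|^{k-1})` (`k ≥ 1`): along `x = ±1` eventually
`|W'(±s)| ≤ (ak+1) s^{k-1}`, and `W'` is bounded on compact intervals. [cite: ReyBelletThomas2002, §1 H1] -/
theorem exists_abs_deriv_le (h : RBGrowth W k) (hk : 1 ≤ k) :
    ∃ C : ℝ, 0 ≤ C ∧ ∀ z : ℝ, |deriv W z| ≤ C * (1 + |z| ^ (k - 1)) := by
  set a := h.coeff with ha
  have ha0 := h.coeff_pos
  have hak : 0 < a * k + 1 := by nlinarith
  have hev : ∀ x : ℝ, |x| = 1 → ∃ S : ℝ, 1 ≤ S ∧ ∀ s, S ≤ s → |deriv W (s * x)| ≤ (a * k + 1) * s ^ (k - 1) := by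
    intro x hx
    have hl : Tendsto (fun s : ℝ => deriv W (s * x) / s ^ (k - 1)) atTop (𝓝 (a * k * x)) := by
      have := h.tendsto_deriv_div_rpow x
      simpa [hx] using this
    have hlim_abs : Tendsto (fun s : ℝ => |deriv W (s * x) / s ^ (k - 1)|) atTop (𝓝 (a * k)) := by
      have := hl.abs
      rwa [abs_mul, abs_of_pos (mul_pos ha0 (by linarith)), hx, mul_one] at this
    have h1 : ∀ᶠ s : ℝ in atTop, |deriv W (s * x) / s ^ (k - 1)| < a * k + 1 :=
      hlim_abs.eventually (gt_mem_nhds (by linarith))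
    obtain ⟨S, hS⟩ := eventually_atTop.1 (h1.and (eventually_ge_atTop 1))
    refine ⟨max S 1, le_max_right _ _, fun s hs => ?_⟩
    obtain ⟨hs1, hs2⟩ := hS s ((le_max_left _ _).trans hs)
    have hsk : 0 < s ^ (k - 1) := Real.rpow_pos_of_pos (by linarith) _
    rw [abs_div, abs_of_pos hsk, div_lt_iff₀ hsk] at hs1
    exact hs1.le
  obtain ⟨S₁, hS₁1, hS₁⟩ := hev 1 (by simp)
  obtain ⟨S₂, hS₂1, hS₂⟩ := hev (-1) (by simp)
  set S := max S₁ S₂ with hS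
  obtain ⟨M, hM⟩ := isCompact_Icc.exists_bound_of_continuousOn
    (h.continuous_deriv.continuousOn (s := Icc (-S) S))
  refine ⟨max (max M 0) (a * k + 1), le_max_of_le_left (le_max_right _ _), fun z => ?_⟩
  have hzk : 0 ≤ |z| ^ (k - 1) := Real.rpow_nonneg (abs_nonneg z) _
  by_cases hz : |z| ≤ S
  · have hmem : z ∈ Icc (-S) S := ⟨by linarith [neg_abs_le z], (le_abs_self z).trans hz⟩
    calc |deriv W z| ≤ M := by simpa [Real.norm_eq_abs] using hM z hmem
      _ ≤ max (max M 0) (a * k + 1) := (le_max_left _ _).trans (le_max_left _ _)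
      _ ≤ max (max M 0) (a * k + 1) * (1 + |z| ^ (k - 1)) :=
          le_mul_of_one_le_right (le_max_of_le_left (le_max_right _ _)) (by linarith)
  · rw [not_le] at hz
    have hbd : |deriv W z| ≤ (a * k + 1) * |z| ^ (k - 1) := by
      rcases le_total 0 z with h0 | h0
      · have := hS₁ |z| ((le_max_left _ _).trans hz.le)
        have hz' : |z| * 1 = z := by rw [mul_one, abs_of_nonneg h0]
        rwa [hz'] at this
      · have := hS₂ |z| ((le_max_right _ _).trans hz.le)
        have hz' : |z| * -1 = z := by rw [abs_of_nonpos h0]; ring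
        rwa [hz'] at this
    calc |deriv W z| ≤ (a * k + 1) * |z| ^ (k - 1) := hbd
      _ ≤ max (max M 0) (a * k + 1) * |z| ^ (k - 1) :=
          mul_le_mul_of_nonneg_right (le_max_right _ _) hzk
      _ ≤ max (max M 0) (a * k + 1) * (1 + |z| ^ (k - 1)) :=
          mul_le_mul_of_nonneg_left (by linarith) (le_max_of_le_left (le_max_right _ _))

/-- `(1 + t)^θ ≤ 2 (1 + t^θ)` for `t ≥ 0` and `0 ≤ θ ≤ 1`. [folklore] -/
theorem one_add_rpow_le_two_mul {t θ : ℝ} (ht : 0 ≤ t) (hθ0 : 0 ≤ θ) (hθ1 : θ ≤ 1) :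
    (1 + t) ^ θ ≤ 2 * (1 + t ^ θ) := by
  rcases le_total t 1 with h1 | h1
  · have : (1 + t) ^ θ ≤ (2 : ℝ) ^ θ := Real.rpow_le_rpow (by positivity) (by linarith) hθ0
    have h2 : (2 : ℝ) ^ θ ≤ 2 ^ (1 : ℝ) := Real.rpow_le_rpow_of_exponent_le (by norm_num) hθ1
    rw [Real.rpow_one] at h2
    have h3 : 0 ≤ t ^ θ := Real.rpow_nonneg ht θ
    linarith
  · have : (1 + t) ^ θ ≤ (2 * t) ^ θ := Real.rpow_le_rpow (by positivity) (by linarith) hθ0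
    rw [Real.mul_rpow (by norm_num) ht] at this
    have h2 : (2 : ℝ) ^ θ ≤ 2 ^ (1 : ℝ) := Real.rpow_le_rpow_of_exponent_le (by norm_num) hθ1
    rw [Real.rpow_one] at h2
    have h3 : 0 ≤ t ^ θ := Real.rpow_nonneg ht θ
    nlinarith

/-- **Growth of the second derivative**: `|W''(z)| ≤ C (1 + |z|^{k-2})` (`k ≥ 2`), from
`|W''| ≤ (C + DW)^{1-2/k}`, `|W| ≤ C'(1 + |z|^k)` and `(1 + |z|^k)^{1-2/k} ≤ 2(1 + |z|^{k-2})`.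
[cite: ReyBelletThomas2002, §1 H1] -/
theorem exists_abs_deriv_deriv_le (h : RBGrowth W k) (hk : 2 ≤ k) :
    ∃ C : ℝ, 0 ≤ C ∧ ∀ z : ℝ, |deriv (deriv W) z| ≤ C * (1 + |z| ^ (k - 2)) := by
  obtain ⟨C, D, hCD⟩ := h.exists_abs_deriv_deriv_le_rpow
  obtain ⟨C', hC', hW⟩ := h.exists_abs_le (by linarith)
  have hk0 : 0 < k := by linarith
  have hθ0 : 0 ≤ 1 - 2 / k := by
    rw [sub_nonneg, div_le_one hk0]; exact hk
  have hθ1 : 1 - 2 / k ≤ 1 := by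
    have : 0 ≤ 2 / k := by positivity
    linarith
  set B : ℝ := |C| + |D| * C' + 1 with hB
  have hB0 : 0 < B := by positivity
  refine ⟨2 * B ^ (1 - 2 / k), by positivity, fun z => ?_⟩
  obtain ⟨hnn, hle⟩ := hCD z
  have hzk : 0 ≤ |z| ^ k := Real.rpow_nonneg (abs_nonneg z) k
  -- `C + D W z ≤ B (1 + |z|^k)`
  have h1 : C + D * W z ≤ B * (1 + |z| ^ k) := by
    have hDW : D * W z ≤ |D| * (C' * (1 + |z| ^ k)) := by
      calc D * W z ≤ |D * W z| := le_abs_self _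
        _ = |D| * |W z| := abs_mul _ _
        _ ≤ |D| * (C' * (1 + |z| ^ k)) := mul_le_mul_of_nonneg_left (hW z) (abs_nonneg _)
    have hC1 : C ≤ |C| * (1 + |z| ^ k) := (le_abs_self C).trans (le_mul_of_one_le_right (abs_nonneg _) (by linarith))
    calc C + D * W z ≤ |C| * (1 + |z| ^ k) + |D| * (C' * (1 + |z| ^ k)) := add_le_add hC1 hDW
      _ = (|C| + |D| * C') * (1 + |z| ^ k) := by ring
      _ ≤ B * (1 + |z| ^ k) := mul_le_mul_of_nonneg_right (by rw [hB]; linarith) (by linarith)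
  calc |deriv (deriv W) z| ≤ (C + D * W z) ^ (1 - 2 / k) := hle
    _ ≤ (B * (1 + |z| ^ k)) ^ (1 - 2 / k) := Real.rpow_le_rpow hnn h1 hθ0
    _ = B ^ (1 - 2 / k) * (1 + |z| ^ k) ^ (1 - 2 / k) := Real.mul_rpow hB0.le (by linarith)
    _ ≤ B ^ (1 - 2 / k) * (2 * (1 + (|z| ^ k) ^ (1 - 2 / k))) :=
        mul_le_mul_of_nonneg_left (one_add_rpow_le_two_mul hzk hθ0 hθ1) (Real.rpow_nonneg hB0.le _)
    _ = 2 * B ^ (1 - 2 / k) * (1 + |z| ^ (k - 2)) := by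
        rw [← Real.rpow_mul (abs_nonneg z)]
        have : k * (1 - 2 / k) = k - 2 := by field_simp
        rw [this]
        ring

/-! ### The rescaled potentials -/

/-- The **rescaled potential** of (19): `Ũ_E(y) = E⁻¹ W(E^{1/k} y)` (for an initial energy `E`,
positions scale by `E^{1/k}`). [cite: ReyBelletThomas2002, §3.1 eq. (19)] -/
def scaledPot (W : ℝ → ℝ) (k E y : ℝ) : ℝ :=
  E⁻¹ * W (E ^ (1 / k) * y)

/-- The **limiting potential** `a |y|^k` of (21). [cite: ReyBelletThomas2002, §3.1 eq. (21)] -/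
def limitPot (a k y : ℝ) : ℝ :=
  a * |y| ^ k

/-- The **limiting force** `a k |y|^{k-2} y = (a|y|^k)'`. [cite: ReyBelletThomas2002, §3.1 eq. (21)] -/
def limitForce (a k y : ℝ) : ℝ :=
  a * k * |y| ^ (k - 2) * y

/-- The derivative of the rescaled potential: `Ũ_E'(y) = E^{1/k-1} W'(E^{1/k} y)` (`E > 0`),
`HasDerivAt` form. [cite: ReyBelletThomas2002, §3.1 eq. (20)] -/
theorem hasDerivAt_scaledPot (h : RBGrowth W k) {E : ℝ} (hE : 0 < E) (y : ℝ) :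
    HasDerivAt (scaledPot W k E) (E ^ (1 / k - 1) * deriv W (E ^ (1 / k) * y)) y := by
  set c : ℝ := E ^ (1 / k) with hc
  have h2 : HasDerivAt (fun y : ℝ => c * y) c y := by
    simpa using (hasDerivAt_id y).const_mul c
  have hd : HasDerivAt (fun y => W (c * y)) (deriv W (c * y) * c) y :=
    (h.differentiable (c * y)).hasDerivAt.comp y h2
  have hd' : HasDerivAt (scaledPot W k E) (E⁻¹ * (deriv W (c * y) * c)) y := hd.const_mul E⁻¹
  convert hd' using 1
  rw [hc, Real.rpow_sub hE, Real.rpow_one]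
  field_simp

/-- The derivative of the rescaled potential, `deriv` form. [cite: ReyBelletThomas2002, §3.1 eq. (20)] -/
theorem deriv_scaledPot (h : RBGrowth W k) {E : ℝ} (hE : 0 < E) (y : ℝ) :
    deriv (scaledPot W k E) y = E ^ (1 / k - 1) * deriv W (E ^ (1 / k) * y) :=
  (h.hasDerivAt_scaledPot hE y).deriv

/-- The second derivative of the rescaled potential: `Ũ_E''(y) = E^{2/k-1} W''(E^{1/k} y)`.
[cite: ReyBelletThomas2002, §3.2 (Prop. 3.7, `O(E^{1-2/k})` in original variables)] -/
theorem deriv_deriv_scaledPot (h : RBGrowth W k) {E : ℝ} (hE : 0 < E) (y : ℝ) :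
    deriv (deriv (scaledPot W k E)) y = E ^ (2 / k - 1) * deriv (deriv W) (E ^ (1 / k) * y) := by
  have hfun : deriv (scaledPot W k E) = fun y => E ^ (1 / k - 1) * deriv W (E ^ (1 / k) * y) :=
    funext fun y => h.deriv_scaledPot hE y
  rw [hfun]
  set c : ℝ := E ^ (1 / k) with hc
  have h2 : HasDerivAt (fun y : ℝ => c * y) c y := by
    simpa using (hasDerivAt_id y).const_mul c
  have hd : HasDerivAt (fun y => deriv W (c * y)) (deriv (deriv W) (c * y) * c) y :=
    (h.differentiable_deriv (c * y)).hasDerivAt.comp y h2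
  rw [(hd.const_mul (E ^ (1 / k - 1))).deriv]
  have : E ^ (2 / k - 1) = E ^ (1 / k - 1) * c := by
    rw [hc, ← Real.rpow_add hE]; congr 1; ring
  rw [this]
  ring

/-- **Pointwise convergence of the rescaled potential**: `Ũ_E(y) → a |y|^k` as `E → ∞`
(substitute `s = E^{1/k}` in H1). [cite: ReyBelletThomas2002, §3.1 eq. (21)] -/
theorem tendsto_scaledPot (h : RBGrowth W k) (hk : 0 < k) (y : ℝ) :
    Tendsto (fun E : ℝ => scaledPot W k E y) atTop (𝓝 (limitPot h.coeff k y)) := by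
  have hs : Tendsto (fun E : ℝ => E ^ (1 / k)) atTop atTop := tendsto_rpow_atTop (by positivity)
  have hlim := (h.tendsto_div_rpow y).comp hs
  refine (hlim.congr' ?_)
  filter_upwards [eventually_gt_atTop 0] with E hE
  simp only [Function.comp_apply, scaledPot]
  rw [← Real.rpow_mul hE.le, one_div_mul_cancel hk.ne', Real.rpow_one]
  field_simp

/-- **Pointwise convergence of the rescaled force**: `Ũ_E'(y) → a k |y|^{k-2} y` as `E → ∞`.
[cite: ReyBelletThomas2002, §3.1 eq. (21)] -/
theorem tendsto_deriv_scaledPot (h : RBGrowth W k) (hk : 0 < k) (y : ℝ) :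
    Tendsto (fun E : ℝ => deriv (scaledPot W k E) y) atTop (𝓝 (limitForce h.coeff k y)) := by
  have hs : Tendsto (fun E : ℝ => E ^ (1 / k)) atTop atTop := tendsto_rpow_atTop (by positivity)
  have hlim := (h.tendsto_deriv_div_rpow y).comp hs
  refine (hlim.congr' ?_)
  filter_upwards [eventually_gt_atTop 0] with E hE
  simp only [Function.comp_apply]
  rw [h.deriv_scaledPot hE, ← Real.rpow_mul hE.le]
  have : 1 / k * (k - 1) = -(1 / k - 1) := by field_simp; ring
  rw [this, Real.rpow_neg hE.le]
  field_simp

/-! ### Uniform bounds for the rescaled potentials on bounded sets (`E ≥ 1`) -/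

/-- Algebra of the rescaling: `(E^{1/k})^θ = E^{θ/k}` and `|E^{1/k} y|^θ = E^{θ/k} |y|^θ` (`E > 0`).
[folklore] -/
theorem abs_rpow_mul_rpow {E : ℝ} (hE : 0 < E) (k θ y : ℝ) :
    |E ^ (1 / k) * y| ^ θ = E ^ (θ / k) * |y| ^ θ := by
  have hEk : 0 < E ^ (1 / k) := Real.rpow_pos_of_pos hE _
  rw [abs_mul, abs_of_pos hEk, Real.mul_rpow hEk.le (abs_nonneg y), ← Real.rpow_mul hE.le]
  congr 2
  ring

/-- **Uniform bound for the rescaled force on bounded sets**: for `k ≥ 1` and `B`, there is `M`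
with `|Ũ_E'(y)| ≤ M` for all `E ≥ 1`, `|y| ≤ B` (from `|W'(z)| ≤ C(1 + |z|^{k-1})`:
`E^{1/k-1}(1 + E^{(k-1)/k}|y|^{k-1}) = E^{1/k-1} + |y|^{k-1}`). [cite: ReyBelletThomas2002, §3.1 eq. (20)] -/
theorem exists_forall_abs_deriv_scaledPot_le (h : RBGrowth W k) (hk : 1 ≤ k) (B : ℝ) :
    ∃ M : ℝ, 0 ≤ M ∧ ∀ E : ℝ, 1 ≤ E → ∀ y : ℝ, |y| ≤ B → |deriv (scaledPot W k E) y| ≤ M := by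
  obtain ⟨C, hC, hW⟩ := h.exists_abs_deriv_le hk
  have hk0 : 0 < k := by linarith
  refine ⟨C * (1 + max B 0 ^ (k - 1)), by positivity, fun E hE y hy => ?_⟩
  have hE0 : 0 < E := by linarith
  rw [h.deriv_scaledPot hE0, abs_mul, abs_of_pos (Real.rpow_pos_of_pos hE0 _)]
  have h1 := hW (E ^ (1 / k) * y)
  rw [abs_rpow_mul_rpow hE0] at h1
  have hEk : E ^ (1 / k - 1) * (1 + E ^ ((k - 1) / k) * |y| ^ (k - 1)) =
      E ^ (1 / k - 1) + |y| ^ (k - 1) := by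
    rw [mul_add, mul_one, ← mul_assoc, ← Real.rpow_add hE0]
    have : 1 / k - 1 + (k - 1) / k = 0 := by field_simp; ring
    rw [this, Real.rpow_zero, one_mul]
  have h2 : E ^ (1 / k - 1) ≤ 1 :=
    Real.rpow_le_one_of_one_le_of_nonpos hE (by rw [sub_nonpos, div_le_one hk0]; exact hk)
  have h3 : |y| ^ (k - 1) ≤ max B 0 ^ (k - 1) :=
    Real.rpow_le_rpow (abs_nonneg y) (le_max_of_le_left hy) (by linarith)
  calc E ^ (1 / k - 1) * |deriv W (E ^ (1 / k) * y)|
      ≤ E ^ (1 / k - 1) * (C * (1 + E ^ ((k - 1) / k) * |y| ^ (k - 1))) :=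
        mul_le_mul_of_nonneg_left h1 (Real.rpow_nonneg hE0.le _)
    _ = C * (E ^ (1 / k - 1) + |y| ^ (k - 1)) := by rw [← hEk]; ring
    _ ≤ C * (1 + max B 0 ^ (k - 1)) := mul_le_mul_of_nonneg_left (add_le_add h2 h3) hC

/-- **Uniform bound for the second derivative of the rescaled potential on bounded sets**: for
`k ≥ 2` and `B`, there is `L` with `|Ũ_E''(y)| ≤ L` for all `E ≥ 1`, `|y| ≤ B`
(`E^{2/k-1}(1 + E^{(k-2)/k}|y|^{k-2}) = E^{2/k-1} + |y|^{k-2}`). This is the equi-Lipschitz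
property of the rescaled forces behind the limit `E → ∞`. [cite: ReyBelletThomas2002, §3.2 Prop 3.7] -/
theorem exists_forall_abs_deriv_deriv_scaledPot_le (h : RBGrowth W k) (hk : 2 ≤ k) (B : ℝ) :
    ∃ L : ℝ, 0 ≤ L ∧ ∀ E : ℝ, 1 ≤ E → ∀ y : ℝ, |y| ≤ B → |deriv (deriv (scaledPot W k E)) y| ≤ L := by
  obtain ⟨C, hC, hW⟩ := h.exists_abs_deriv_deriv_le hk
  have hk0 : 0 < k := by linarith
  refine ⟨C * (1 + max B 0 ^ (k - 2)), by positivity, fun E hE y hy => ?_⟩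
  have hE0 : 0 < E := by linarith
  rw [h.deriv_deriv_scaledPot hE0, abs_mul, abs_of_pos (Real.rpow_pos_of_pos hE0 _)]
  have h1 := hW (E ^ (1 / k) * y)
  rw [abs_rpow_mul_rpow hE0] at h1
  have hEk : E ^ (2 / k - 1) * (1 + E ^ ((k - 2) / k) * |y| ^ (k - 2)) =
      E ^ (2 / k - 1) + |y| ^ (k - 2) := by
    rw [mul_add, mul_one, ← mul_assoc, ← Real.rpow_add hE0]
    have : 2 / k - 1 + (k - 2) / k = 0 := by field_simp; ring
    rw [this, Real.rpow_zero, one_mul]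
  have h2 : E ^ (2 / k - 1) ≤ 1 :=
    Real.rpow_le_one_of_one_le_of_nonpos hE (by rw [sub_nonpos, div_le_one hk0]; exact hk)
  have h3 : |y| ^ (k - 2) ≤ max B 0 ^ (k - 2) :=
    Real.rpow_le_rpow (abs_nonneg y) (le_max_of_le_left hy) (by linarith)
  calc E ^ (2 / k - 1) * |deriv (deriv W) (E ^ (1 / k) * y)|
      ≤ E ^ (2 / k - 1) * (C * (1 + E ^ ((k - 2) / k) * |y| ^ (k - 2))) :=
        mul_le_mul_of_nonneg_left h1 (Real.rpow_nonneg hE0.le _)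
    _ = C * (E ^ (2 / k - 1) + |y| ^ (k - 2)) := by rw [← hEk]; ring
    _ ≤ C * (1 + max B 0 ^ (k - 2)) := mul_le_mul_of_nonneg_left (add_le_add h2 h3) hC

/-- **The rescaled potentials are equi-Lipschitz on bounded sets** (`k ≥ 1`, `E ≥ 1`).
[cite: ReyBelletThomas2002, §3.1 eq. (20)] -/
theorem exists_forall_abs_scaledPot_sub_le (h : RBGrowth W k) (hk : 1 ≤ k) (B : ℝ) :
    ∃ M : ℝ, 0 ≤ M ∧ ∀ E : ℝ, 1 ≤ E → ∀ y₁ ∈ Icc (-B) B, ∀ y₂ ∈ Icc (-B) B,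
      |scaledPot W k E y₁ - scaledPot W k E y₂| ≤ M * |y₁ - y₂| := by
  obtain ⟨M, hM, hb⟩ := h.exists_forall_abs_deriv_scaledPot_le hk B
  refine ⟨M, hM, fun E hE y₁ hy₁ y₂ hy₂ => ?_⟩
  have hE0 : 0 < E := by linarith
  have h := Convex.norm_image_sub_le_of_norm_deriv_le (f := scaledPot W k E) (s := Icc (-B) B)
    (fun x _ => (h.hasDerivAt_scaledPot hE0 x).differentiableAt)
    (fun x hx => by rw [Real.norm_eq_abs]; exact hb E hE x (abs_le.2 hx)) (convex_Icc _ _) hy₂ hy₁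
  simpa [Real.norm_eq_abs] using h

/-- **The rescaled forces are equi-Lipschitz on bounded sets** (`k ≥ 2`, `E ≥ 1`).
[cite: ReyBelletThomas2002, §3.2 Prop 3.7] -/
theorem exists_forall_abs_deriv_scaledPot_sub_le (h : RBGrowth W k) (hk : 2 ≤ k) (B : ℝ) :
    ∃ L : ℝ, 0 ≤ L ∧ ∀ E : ℝ, 1 ≤ E → ∀ y₁ ∈ Icc (-B) B, ∀ y₂ ∈ Icc (-B) B,
      |deriv (scaledPot W k E) y₁ - deriv (scaledPot W k E) y₂| ≤ L * |y₁ - y₂| := by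
  obtain ⟨L, hL, hb⟩ := h.exists_forall_abs_deriv_deriv_scaledPot_le hk B
  refine ⟨L, hL, fun E hE y₁ hy₁ y₂ hy₂ => ?_⟩
  have hE0 : 0 < E := by linarith
  have hdiff : ∀ x : ℝ, DifferentiableAt ℝ (deriv (scaledPot W k E)) x := by
    intro x
    have hfun : deriv (scaledPot W k E) = fun y => E ^ (1 / k - 1) * deriv W (E ^ (1 / k) * y) :=
      funext fun y => h.deriv_scaledPot hE0 y
    rw [hfun]
    exact ((h.differentiable_deriv _).comp x ((differentiable_id.const_mul _) x)).const_mul _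
  have h := Convex.norm_image_sub_le_of_norm_deriv_le (f := deriv (scaledPot W k E)) (s := Icc (-B) B)
    (fun x _ => hdiff x) (fun x hx => by rw [Real.norm_eq_abs]; exact hb E hE x (abs_le.2 hx))
    (convex_Icc _ _) hy₂ hy₁
  simpa [Real.norm_eq_abs] using h

/-! ### From pointwise to uniform convergence for equi-Lipschitz families -/

/-- **Equi-Lipschitz families converging pointwise converge uniformly on compact intervals**: if
eventually all `f_E` are `L`-Lipschitz on `[a, b]`, `F` is `L`-Lipschitz there and `f_E → F`
pointwise on `[a, b]`, then `sup_{[a,b]} |f_E - F| → 0` (finite net). [folklore] -/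
theorem eventually_forall_abs_sub_le_of_lipschitz {f : ℝ → ℝ → ℝ} {F : ℝ → ℝ} {a b L : ℝ}
    (hab : a ≤ b) (hL : 0 ≤ L)
    (hf : ∀ᶠ E in atTop, ∀ y₁ ∈ Icc a b, ∀ y₂ ∈ Icc a b, |f E y₁ - f E y₂| ≤ L * |y₁ - y₂|)
    (hF : ∀ y₁ ∈ Icc a b, ∀ y₂ ∈ Icc a b, |F y₁ - F y₂| ≤ L * |y₁ - y₂|)
    (hpt : ∀ y ∈ Icc a b, Tendsto (fun E => f E y) atTop (𝓝 (F y))) {ε : ℝ} (hε : 0 < ε) :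
    ∀ᶠ E in atTop, ∀ y ∈ Icc a b, |f E y - F y| ≤ ε := by
  -- spacing of the net
  set δ : ℝ := ε / (3 * (L + 1)) with hδ
  have hδ0 : 0 < δ := by positivity
  have hLδ : L * δ ≤ ε / 3 := by
    rw [hδ, mul_div_assoc', div_le_div_iff₀ (by positivity) (by positivity)]
    nlinarith
  obtain ⟨J, hJ⟩ : ∃ J : ℕ, (b - a) / δ ≤ J := exists_nat_ge _
  -- the net, clipped to `[a, b]`
  set net : ℕ → ℝ := fun j => min (a + j * δ) b with hnet
  have hnet_mem : ∀ j, net j ∈ Icc a b := fun j =>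
    ⟨le_min (by nlinarith [hδ0.le, (Nat.cast_nonneg j : (0 : ℝ) ≤ j)]) hab, min_le_right _ _⟩
  -- eventually all net points are `ε/3`-close
  have hev : ∀ᶠ E in atTop, ∀ j ∈ Finset.range (J + 1), |f E (net j) - F (net j)| ≤ ε / 3 := by
    refine (Finset.eventually_all _).2 fun j _ => ?_
    have h := (Metric.tendsto_nhds.1 (hpt (net j) (hnet_mem j))) (ε / 3) (by positivity)
    exact h.mono fun E hE => by rw [Real.dist_eq] at hE; exact hE.le
  filter_upwards [hev, hf] with E hE hfE y hy
  -- the net point just below `y`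
  set j : ℕ := ⌊(y - a) / δ⌋₊ with hjdef
  have hya : 0 ≤ (y - a) / δ := div_nonneg (sub_nonneg.2 hy.1) hδ0.le
  have hjle : (j : ℝ) ≤ (y - a) / δ := Nat.floor_le hya
  have hjlt : (y - a) / δ < j + 1 := Nat.lt_floor_add_one _
  have hjJ : j ∈ Finset.range (J + 1) := by
    rw [Finset.mem_range, Nat.lt_succ_iff]
    have : (j : ℝ) ≤ J := hjle.trans ((div_le_div_of_nonneg_right (by linarith [hy.2]) hδ0.le).trans hJ)
    exact_mod_cast this
  have hj1 : a + j * δ ≤ y := by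
    rw [le_div_iff₀ hδ0] at hjle; linarith
  have hj2 : y < a + (j + 1) * δ := by
    rw [div_lt_iff₀ hδ0] at hjlt; linarith
  have hnetj : net j = a + j * δ := min_eq_left (hj1.trans hy.2)
  have hclose : |y - net j| ≤ δ := by
    rw [hnetj, abs_of_nonneg (by linarith)]
    nlinarith
  have e1 := hfE y hy (net j) (hnet_mem j)
  have e2 := hE j hjJ
  have e3 := hF (net j) (hnet_mem j) y hy
  have hLy : L * |y - net j| ≤ ε / 3 := (mul_le_mul_of_nonneg_left hclose hL).trans hLδ
  have hLy' : L * |net j - y| ≤ ε / 3 := by rwa [abs_sub_comm] at hLy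
  calc |f E y - F y| = |(f E y - f E (net j)) + (f E (net j) - F (net j)) + (F (net j) - F y)| := by
        ring_nf
    _ ≤ |f E y - f E (net j)| + |f E (net j) - F (net j)| + |F (net j) - F y| :=
        (abs_add_le _ _).trans (add_le_add (abs_add_le _ _) le_rfl)
    _ ≤ ε / 3 + ε / 3 + ε / 3 := add_le_add (add_le_add (e1.trans hLy) e2) (e3.trans hLy')
    _ = ε := by ring

/-- **A pointwise limit of `L`-Lipschitz functions is `L`-Lipschitz.** [folklore] -/
theorem lipschitz_of_tendsto {f : ℝ → ℝ → ℝ} {F : ℝ → ℝ} {s : Set ℝ} {L : ℝ}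
    (hf : ∀ᶠ E in atTop, ∀ y₁ ∈ s, ∀ y₂ ∈ s, |f E y₁ - f E y₂| ≤ L * |y₁ - y₂|)
    (hpt : ∀ y ∈ s, Tendsto (fun E => f E y) atTop (𝓝 (F y))) :
    ∀ y₁ ∈ s, ∀ y₂ ∈ s, |F y₁ - F y₂| ≤ L * |y₁ - y₂| := by
  intro y₁ hy₁ y₂ hy₂
  have hlim : Tendsto (fun E => |f E y₁ - f E y₂|) atTop (𝓝 |F y₁ - F y₂|) :=
    ((hpt y₁ hy₁).sub (hpt y₂ hy₂)).abs
  exact le_of_tendsto hlim (hf.mono fun E hE => hE y₁ hy₁ y₂ hy₂)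

/-- **Uniform convergence of the rescaled potential on bounded sets**: `sup_{|y| ≤ B} |Ũ_E(y) - a|y|^k| → 0`
as `E → ∞` (`k ≥ 1`). [cite: ReyBelletThomas2002, §3.1 eq. (21)] -/
theorem eventually_forall_abs_scaledPot_sub_limitPot_le (h : RBGrowth W k) (hk : 1 ≤ k) (B : ℝ)
    {ε : ℝ} (hε : 0 < ε) :
    ∀ᶠ E in atTop, ∀ y ∈ Icc (-B) B, |scaledPot W k E y - limitPot h.coeff k y| ≤ ε := by
  rcases lt_or_ge B (-B) with hB | hB
  · exact Eventually.of_forall fun E y hy => absurd (hy.1.trans hy.2) (not_le.2 hB)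
  obtain ⟨M, hM, hlip⟩ := h.exists_forall_abs_scaledPot_sub_le hk B
  have hf : ∀ᶠ E in atTop, ∀ y₁ ∈ Icc (-B) B, ∀ y₂ ∈ Icc (-B) B,
      |scaledPot W k E y₁ - scaledPot W k E y₂| ≤ M * |y₁ - y₂| :=
    (eventually_ge_atTop 1).mono fun E hE => hlip E hE
  have hpt : ∀ y ∈ Icc (-B) B, Tendsto (fun E => scaledPot W k E y) atTop (𝓝 (limitPot h.coeff k y)) :=
    fun y _ => h.tendsto_scaledPot (by linarith) y
  exact eventually_forall_abs_sub_le_of_lipschitz hB hM hf (lipschitz_of_tendsto hf hpt) hpt hε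

/-- **Uniform convergence of the rescaled force on bounded sets**:
`sup_{|y| ≤ B} |Ũ_E'(y) - a k |y|^{k-2} y| → 0` as `E → ∞` (`k ≥ 2`).
[cite: ReyBelletThomas2002, §3.1 eq. (21)] -/
theorem eventually_forall_abs_deriv_scaledPot_sub_limitForce_le (h : RBGrowth W k) (hk : 2 ≤ k)
    (B : ℝ) {ε : ℝ} (hε : 0 < ε) :
    ∀ᶠ E in atTop, ∀ y ∈ Icc (-B) B, |deriv (scaledPot W k E) y - limitForce h.coeff k y| ≤ ε := by
  rcases lt_or_ge B (-B) with hB | hB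
  · exact Eventually.of_forall fun E y hy => absurd (hy.1.trans hy.2) (not_le.2 hB)
  obtain ⟨L, hL, hlip⟩ := h.exists_forall_abs_deriv_scaledPot_sub_le hk B
  have hf : ∀ᶠ E in atTop, ∀ y₁ ∈ Icc (-B) B, ∀ y₂ ∈ Icc (-B) B,
      |deriv (scaledPot W k E) y₁ - deriv (scaledPot W k E) y₂| ≤ L * |y₁ - y₂| :=
    (eventually_ge_atTop 1).mono fun E hE => hlip E hE
  have hpt : ∀ y ∈ Icc (-B) B, Tendsto (fun E => deriv (scaledPot W k E) y) atTop
      (𝓝 (limitForce h.coeff k y)) := fun y _ => h.tendsto_deriv_scaledPot (by linarith) y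
  exact eventually_forall_abs_sub_le_of_lipschitz hB hL hf (lipschitz_of_tendsto hf hpt) hpt hε

/-- **The limiting force is Lipschitz on bounded sets** (`k ≥ 2`), as a pointwise limit of the
equi-Lipschitz rescaled forces. [folklore] -/
theorem exists_forall_abs_limitForce_sub_le (h : RBGrowth W k) (hk : 2 ≤ k) (B : ℝ) :
    ∃ L : ℝ, 0 ≤ L ∧ ∀ y₁ ∈ Icc (-B) B, ∀ y₂ ∈ Icc (-B) B,
      |limitForce h.coeff k y₁ - limitForce h.coeff k y₂| ≤ L * |y₁ - y₂| := by
  obtain ⟨L, hL, hlip⟩ := h.exists_forall_abs_deriv_scaledPot_sub_le hk B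
  have hf : ∀ᶠ E in atTop, ∀ y₁ ∈ Icc (-B) B, ∀ y₂ ∈ Icc (-B) B,
      |deriv (scaledPot W k E) y₁ - deriv (scaledPot W k E) y₂| ≤ L * |y₁ - y₂| :=
    (eventually_ge_atTop 1).mono fun E hE => hlip E hE
  have hpt : ∀ y ∈ Icc (-B) B, Tendsto (fun E => deriv (scaledPot W k E) y) atTop
      (𝓝 (limitForce h.coeff k y)) := fun y _ => h.tendsto_deriv_scaledPot (by linarith) y
  exact ⟨L, hL, lipschitz_of_tendsto hf hpt⟩

/-- **Uniform coercivity of the rescaled potentials**: `Ũ_E(y) ≥ a/2 |y|^k - C/E` (`E > 0`,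
`k > 0`). [cite: ReyBelletThomas2002, §3.1] -/
theorem scaledPot_ge (h : RBGrowth W k) (hk : 0 < k) :
    ∃ C : ℝ, 0 ≤ C ∧ ∀ E : ℝ, 0 < E → ∀ y : ℝ, h.coeff / 2 * |y| ^ k - C / E ≤ scaledPot W k E y := by
  obtain ⟨C, hC, hW⟩ := h.exists_rpow_sub_le hk
  refine ⟨C, hC, fun E hE y => ?_⟩
  unfold scaledPot
  have h1 := hW (E ^ (1 / k) * y)
  rw [abs_rpow_mul_rpow hE, div_self hk.ne', Real.rpow_one] at h1
  have hEi : 0 < E⁻¹ := inv_pos.2 hE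
  have key : E⁻¹ * (h.coeff / 2 * (E * |y| ^ k) - C) = h.coeff / 2 * |y| ^ k - C / E := by
    field_simp
  calc h.coeff / 2 * |y| ^ k - C / E = E⁻¹ * (h.coeff / 2 * (E * |y| ^ k) - C) := key.symm
    _ ≤ E⁻¹ * W (E ^ (1 / k) * y) := mul_le_mul_of_nonneg_left h1 hEi.le

/-- **Uniform upper bound of the rescaled potentials**: `Ũ_E(y) ≤ C (1/E + |y|^k)` (`E > 0`).
[cite: ReyBelletThomas2002, §3.1] -/
theorem scaledPot_le (h : RBGrowth W k) (hk : 0 < k) :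
    ∃ C : ℝ, 0 ≤ C ∧ ∀ E : ℝ, 0 < E → ∀ y : ℝ, scaledPot W k E y ≤ C * (1 / E + |y| ^ k) := by
  obtain ⟨C, hC, hW⟩ := h.exists_le_mul_one_add_rpow
  refine ⟨C, hC, fun E hE y => ?_⟩
  unfold scaledPot
  have h1 := hW (E ^ (1 / k) * y)
  rw [abs_rpow_mul_rpow hE, div_self hk.ne', Real.rpow_one] at h1
  have : C * (1 / E + |y| ^ k) = E⁻¹ * (C * (1 + E * |y| ^ k)) := by
    field_simp
  rw [this]
  exact mul_le_mul_of_nonneg_left h1 (inv_nonneg.2 hE.le)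

end RBGrowth

end Literature.MathematicalPhysics.KineticTheory.HeatConduction

end
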